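import Literature.Probability.LatticeModels.HighDimTrivialityAssembly
import Literature.Probability.LatticeModels.HighDimTrivialityProofs
import Literature.Probability.LatticeModels.HighDimTrivialityUrsellSum
import Literature.Probability.LatticeModels.AizenmanWickBoundProofs
import HarnessLib

/-!
# High-dimensional triviality of Ising scaling limits, VII: crit-ising.S13 with the current trust base

Topic `Literature/Probability/LatticeModels`; family `crit-ising` (crit-ising.S13). Proof companion of
`HighDimTrivialityAssembly` (theorems only: no definition, no statement and no named fact is
introduced or changed). It records where the `Sweep1` statement
`isGaussianProcess_of_tendstoInDistribution_smearedSpin` — for `d ≥ 4`, every subsequential limit in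
law of the rescaled spin field of the nearest-neighbour Ising model along arbitrary `β_k ∈ [0, β_c]`,
meshes `δ_k → 0⁺` and renormalisations with bounded second moments is a Gaussian generalised random
field (Aizenman–Duminil-Copin, Ann. of Math. 194 (2021), Thm 1.2 with Def. 1.1, `d = 4`;
Aizenman, CMP 86 (1982) and Fröhlich, NPB 200 (1982), `d ≥ 5`) — stands after the discharges of
2026-08:

* **The assembly is re-threaded onto the source form of Aizenman's inequality.** The reduction
  `isGaussianProcess_of_tendstoInDistribution_smearedSpin_of_facts` of `HighDimTrivialityAssembly`
  takes the smeared moment bound `aizenman_evenMoment_deviation_le` as a hypothesis, and that named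
  fact — the form of Aizenman's inequality quoted in Aizenman–Duminil-Copin 2021, (6.44)–(6.45), with
  `⟨T_{|f|,L}^{2n-4}⟩` in the remainder — is refuted in the tree
  (`not_aizenman_evenMoment_deviation_le`, `AizenmanWickBoundRefutations`), so that reduction is
  vacuous. The theorem actually proved by Aizenman (CMP 86 (1982), Prop. 12.1: the Wick functional
  `G_{2n-4}` of the remaining points) is the tree's `aizenman_wickDeviation_le_finite`, DISCHARGED in
  `AizenmanWickBoundProofs` (`aizenman_wickDeviation_le_finite_holds`); its summed form
  `abs_mgf_normalizedField_sub_exp_le_of_wickBounds` (`AizenmanWickBound`, Part 5) has exactly the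
  shape of the hypothesis `hmgf` of `isGaussianProcess_of_tendstoInDistribution_smearedSpin_of_mgfBound`.
  `abs_mgf_normalizedField_sub_exp_le_dlr` below is that bound for every DLR state `μ ∈ 𝒢(β, 0)`,
  `0 ≤ β ≤ β_c`, `d ≥ 3`, with no hypothesis left: uniqueness below and at `β_c`
  (`hasUniqueGibbsMeasure_of_lt_criticalBeta_holds`, `hasUniqueGibbsMeasure_criticalBeta_holds`), the
  free state (`exists_freeMeasure_holds`), Newman's Gaussian inequality
  (`aizenman_nPoint_le_pairingSum_finite_holds`) and the flip symmetry
  (`oddSpinCorrelation_eq_zero_holds`) are theorems of the tree.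
* **One named fact remains.** Of the eight inputs listed in `HighDimTrivialityAssembly`, seven are
  now theorems (`newman_evenMoment_le_holds`, `aizenman_treeDiagramBound_holds`,
  `panis_ursellFourSum_le_holds`, the two uniqueness theorems, `exists_freeMeasure_holds`, and Prop. 12.1
  in place of the refuted moment bound). The statement therefore follows from the single named fact
  `panis_ursellFourSum_le_four` (`HighDimTrivialityUniform`): Panis, Ann. Probab. 54 (2026) =
  arXiv:2309.05797, Cor. 1.8 with its proof §6.6 (p. 33) — the `d = 4` bound
  `Σ_L⁻² ∑_{Λ_{rL}⁴} |U₄| ≤ C r^γ (log L)^{-c}` in the sharp-length window `L ≤ L(β)`, i.e. the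
  multiscale improvement of the tree diagram bound of Aizenman–Duminil-Copin 2021, Thms 1.3 and 5.6.
  This is `isGaussianProcess_of_tendstoInDistribution_smearedSpin_of_panis_four`; the discharge
  `…_holds` is that theorem applied to `panis_ursellFourSum_le_four_holds` once the latter lands.
* **`d ≥ 5` is unconditional.** Restricted to `d ≥ 5` (Aizenman 1982 / Fröhlich 1982, the classical
  triviality theorem, in the `Sweep1` form with arbitrary `β_k ∈ [0, β_c]`), the statement is a
  THEOREM of the tree: `isGaussianProcess_of_tendstoInDistribution_smearedSpin_of_five_le` (the `d ≥ 5`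
  branch of the uniform smallness `ursellFourSum_uniformlySmall_of_facts'`, re-run with the discharged
  inputs: `ursellFourSum_uniformlySmall_of_five_le`).

## References

* M. Aizenman, H. Duminil-Copin, Ann. of Math. (2) 194 (2021) 163–235 = arXiv:1912.07973, Def. 1.1,
  Thm 1.2, Thm 1.3, Prop. 1.4 (pp. 4–6), §6.3 (p. 26) [AizenmanDuminilCopinAnnals2021] (read pp. 4–6).
* R. Panis, Ann. Probab. 54 (2026) = arXiv:2309.05797, Thm 1.2, Cor. 1.8 (p. 8), Thm 5.5 and its
  proof (pp. 21–22), §6.6 (p. 33) [Panis2023Triviality] (read pp. 6–8, 21–22, 33).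
* M. Aizenman, Comm. Math. Phys. 86 (1982) 1–48, Prop. 12.1 and §1 [AizenmanCMP1982];
  J. Fröhlich, Nucl. Phys. B 200 (1982) 281–296 [FrohlichTrivialityNPB1982].

## Mathlib

`MeasureTheory.TendstoInDistribution`, `ProbabilityTheory.IsGaussianProcess`, `Filter.Tendsto`
algebra; no definitions.
-/

noncomputable section

open MeasureTheory ProbabilityTheory Filter Topology TopologicalSpace
open scoped NNReal
open Literature.Probability.LatticeModels Literature.Probability.Percolation

namespace Literature.Probability.LatticeModels

variable {d : ℕ}

/-! ### The summed moment bound for every DLR state, unconditionally -/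

/-- **The third display of Aizenman–Duminil-Copin 2021, §6.3 / Aizenman CDM 2020, (7.9), for every
DLR state up to `β_c`, with no named fact left.** For the nearest-neighbour ferromagnetic Ising model
on `ℤ^d`, `d ≥ 3`, `0 ≤ β ≤ β_c`, `μ ∈ 𝒢(β, 0)`, `L > 0`, `f ∈ C_0(ℝ^d)` vanishing outside
`[-r, r]^d` and real `z`:
`|⟨exp(z T_{f,L})⟩_μ - exp(z²/2 ⟨T_{f,L}²⟩_μ)| ≤ exp(z²/2 ⟨T_{|f|,L}²⟩_μ) · 24 ‖f‖_∞⁴ S(μ; L, r) z⁴`,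
`S(μ; L, r) = ursellFourSum μ L r`. Proof: `𝒢(β, 0)` is a singleton whose element is the free state
(`hasUniqueGibbsMeasure_of_lt_criticalBeta_holds`, `hasUniqueGibbsMeasure_criticalBeta_holds`,
`exists_freeMeasure_holds`), which satisfies Newman's Gaussian lower bound and Aizenman's Prop. 12.1
(`pairingLowerBound_and_wickDeviationBound_of_freeCorr` fed with the discharged
`aizenman_wickDeviation_le_finite_holds`) and has vanishing odd correlations
(`oddSpinCorrelation_eq_zero_holds`); the summation over `n` is
`abs_mgf_normalizedField_sub_exp_le_of_wickBounds`. [cite: AizenmanDuminilCopinAnnals2021, arXiv:1912.07973 §6.3, third display (p. 26)] -/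
theorem abs_mgf_normalizedField_sub_exp_le_dlr (hd : 3 ≤ d) {β L r : ℝ} (hβ : 0 ≤ β)
    (hβc : β ≤ criticalBeta d) (hL : 0 < L) {μ : Measure (SpinConfig (Site d))}
    (hμ : μ ∈ isingGibbsMeasures d β 0) {f : EuclideanSpace ℝ (Fin d) → ℝ} (hf : Continuous f)
    (hfr : ∀ x, f x ≠ 0 → ∀ i, |x i| ≤ r) (z : ℝ) :
    |(∫ σ, Real.exp (z * normalizedField μ L f σ) ∂μ) -
        Real.exp (z ^ 2 / 2 * ∫ σ, normalizedField μ L f σ ^ 2 ∂μ)|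
      ≤ Real.exp (z ^ 2 / 2 * ∫ σ, normalizedField μ L (fun x => |f x|) σ ^ 2 ∂μ) *
          (24 * (⨆ x, |f x|) ^ 4 * ursellFourSum μ L r * z ^ 4) := by
  haveI : IsProbabilityMeasure μ := hμ.1
  -- `μ` is the free state
  obtain ⟨μf, hμf, -, hcorr⟩ := exists_freeMeasure_holds d (β := β) 0 hβ le_rfl
  have huniq : HasUniqueGibbsMeasure (isingSpecification (zdGraph d) β 0) := by
    rcases hβc.lt_or_eq with hlt | heq
    · exact hasUniqueGibbsMeasure_of_lt_criticalBeta_holds (by omega) hβ hlt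
    · rw [heq]
      exact hasUniqueGibbsMeasure_criticalBeta_holds (by omega)
  have hμeq : μ = μf := huniq.1 hμ hμf
  subst hμeq
  obtain ⟨hlow, hWμ⟩ := pairingLowerBound_and_wickDeviationBound_of_freeCorr
    aizenman_wickDeviation_le_finite_holds hβ hcorr
  -- odd correlations vanish (flip symmetry of the unique state)
  have hodd : ∀ {n : ℕ}, Odd n → ∀ x : Fin n → Site d, ∫ σ, ∏ i, spinAt (x i) σ ∂μ = 0 :=
    fun hn x => oddSpinCorrelation_eq_zero_holds hd β hβ hβc μ hμ hn x
  exact abs_mgf_normalizedField_sub_exp_le_of_wickBounds hlow hWμ hodd hL hf hfr z (r := r)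

/-! ### crit-ising.S13 (`Sweep1` form) from Panis's Corollary 1.8 alone -/

/-- **Uniform smallness of `S(μ; L, r)` from the single named fact `panis_ursellFourSum_le_four`**:
for `d ≥ 4`, `r ≥ 1` and `ε > 0` there is `L₀` with `Σ_L⁻² ∑_{x ∈ Λ_{rL}⁴} |U₄^μ(x)| ≤ ε` for all
`L ≥ L₀`, all `β ∈ [0, β_c]` and all `μ ∈ 𝒢(β, 0)`
(`ursellFourSum_uniformlySmall_of_facts` of `HighDimTrivialityUniformProofs` with its other inputs
discharged: `aizenman_treeDiagramBound_holds`, `panis_ursellFourSum_le_holds`, the two uniqueness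
theorems and `exists_freeMeasure_holds`). A derived statement (no source prints the uniformity in
`β`; the regimes combined are those of Panis 2023, §1.2.1), kept as the conclusion of this theorem
rather than as a named `Prop`. [cite: Panis2023Triviality, Cor. 1.8 with its proof §6.6 (p. 33); Thm. 5.5; §1.2.1 fn. 2] -/
theorem ursellFourSum_uniformlySmall_of_panis_four (hP₄ : panis_ursellFourSum_le_four) :
    ∀ {d : ℕ}, 4 ≤ d → ∀ r : ℝ, 1 ≤ r → ∀ ε : ℝ, 0 < ε → ∃ L₀ : ℝ,
      ∀ (β L : ℝ), 0 ≤ β → β ≤ criticalBeta d → L₀ ≤ L →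
      ∀ μ ∈ isingGibbsMeasures d β 0, ursellFourSum μ L r ≤ ε :=
  ursellFourSum_uniformlySmall_of_facts aizenman_treeDiagramBound_holds hP₄
    panis_ursellFourSum_le_holds
    (fun {_} {_} => hasUniqueGibbsMeasure_of_lt_criticalBeta_holds)
    (fun {_} => hasUniqueGibbsMeasure_criticalBeta_holds)
    (fun d {_} => exists_freeMeasure_holds d 0)

universe u in
/-- **crit-ising.S13 in its original (`Sweep1`) form from ONE named fact.** The statement
`isGaussianProcess_of_tendstoInDistribution_smearedSpin` (Aizenman–Duminil-Copin 2021, Thm 1.2 with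
Def. 1.1 — "a possible restriction to a subsequence along which also the other parameters are allowed
to vary" — for `d = 4`; Aizenman 1982 / Fröhlich 1982 for `d ≥ 5`) follows from Panis 2023, Cor. 1.8
in the form `panis_ursellFourSum_le_four` (the `d = 4` bound on `Σ_L⁻² ∑ |U₄|` in the sharp-length
window, i.e. the multiscale improvement of the tree diagram bound of Aizenman–Duminil-Copin 2021,
Thms 1.3 and 5.6): the exponential-moment bound is `abs_mgf_normalizedField_sub_exp_le_dlr`
(unconditional), the variance bounds are `normalizedField_variance_bounds_holds`, the uniform
smallness is `ursellFourSum_uniformlySmall_of_panis_four hP₄`, and the probabilistic assembly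
(renormalisation, exponential moments along convergence in law, `complexMGF` uniqueness, linearity)
is `isGaussianProcess_of_tendstoInDistribution_smearedSpin_of_mgfBound`. The discharge
`isGaussianProcess_of_tendstoInDistribution_smearedSpin_holds` is this theorem applied to
`panis_ursellFourSum_le_four_holds` once that fact is proved. [cite: AizenmanDuminilCopinAnnals2021, arXiv:1912.07973 Thm 1.2 with Def. 1.1 (p. 4) and Prop. 1.4, §6.3 (pp. 6, 26)] -/
theorem isGaussianProcess_of_tendstoInDistribution_smearedSpin_of_panis_four
    (hP₄ : panis_ursellFourSum_le_four) :
    isGaussianProcess_of_tendstoInDistribution_smearedSpin.{u} :=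
  isGaussianProcess_of_tendstoInDistribution_smearedSpin_of_mgfBound
    (fun {_} hd {_ _ _} hβ hβc hL _ {_} hμ {_} hf hfr z =>
      abs_mgf_normalizedField_sub_exp_le_dlr (by omega) hβ hβc hL hμ hf hfr z)
    normalizedField_variance_bounds_holds (ursellFourSum_uniformlySmall_of_panis_four hP₄)

/-! ### `d ≥ 5`: crit-ising.S13 is a theorem of the tree -/

/-- **Uniform smallness of `S(μ; L, r)` for `d ≥ 5`, unconditionally**: for every `r ≥ 1` and
`ε > 0` there is `L₀` with `Σ_L⁻² ∑_{x ∈ Λ_{rL}⁴} |U₄^μ(x)| ≤ ε` for all `L ≥ L₀`, all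
`β ∈ [0, β_c]` and all `μ ∈ 𝒢(β, 0)`. This is the `d ≥ 5` branch of
`ursellFourSum_uniformlySmall_of_facts'` (`HighDimTrivialityUniformProofs`) with every input a theorem:
below a high-temperature scale `β₀` the plain tree diagram bound (`aizenman_treeDiagramBound_holds`)
with the saturation of the susceptibility (`ursellFourSum_le_of_le_smallBeta`), above it Panis's
Thm 5.5 (`panis_ursellFourSum_le_holds`), whose constant `C (β⁻⁴ ∨ β⁻²)` is then bounded by its value
at `β₀`. [cite: Panis2023Triviality, Thm. 5.5 (proof pp. 21–22) and §1.2.1 fn. 2] -/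
theorem ursellFourSum_uniformlySmall_of_five_le (hd : 5 ≤ d) {r : ℝ} (hr : 1 ≤ r) {ε : ℝ}
    (hε : 0 < ε) :
    ∃ L₀ : ℝ, ∀ (β L : ℝ), 0 ≤ β → β ≤ criticalBeta d → L₀ ≤ L →
      ∀ μ ∈ isingGibbsMeasures d β 0, ursellFourSum μ L r ≤ ε := by
  have hd3 : 3 ≤ d := by omega
  have hr0 : 0 < r := one_pos.trans_le hr
  have hU₁ : ∀ {d : ℕ} {β : ℝ}, hasUniqueGibbsMeasure_of_lt_criticalBeta (d := d) (β := β) :=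
    fun {_} {_} => hasUniqueGibbsMeasure_of_lt_criticalBeta_holds
  have hU₂ : ∀ {d : ℕ}, hasUniqueGibbsMeasure_criticalBeta (d := d) :=
    fun {_} => hasUniqueGibbsMeasure_criticalBeta_holds
  have hF : ∀ (d : ℕ) {β : ℝ}, exists_freeMeasure d (β := β) 0 :=
    fun d {_} => exists_freeMeasure_holds d 0
  have hT : aizenman_treeDiagramBound := aizenman_treeDiagramBound_holds
  -- high-temperature scale `β₀` and the small-`β` regime
  obtain ⟨β₀, hβ₀, hφ₀⟩ := exists_beta_dctIsingPhi_singleton_lt (d := d)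
  set A₁ : ℝ := 32 * 12 ^ d * r ^ d with hA₁
  have hA₁0 : 0 ≤ A₁ := by positivity
  have hsmall : ∀ (β L : ℝ), 0 ≤ β → β ≤ β₀ → β ≤ criticalBeta d → A₁ / ε + 2 ≤ L →
      ∀ μ ∈ isingGibbsMeasures d β 0, ursellFourSum μ L r ≤ ε := by
    intro β L hβ hββ₀ hβc hL μ hμ
    have hL2 : 2 ≤ L := by have := div_nonneg hA₁0 hε.le; linarith
    have hL1 : 1 ≤ L := by linarith
    refine (ursellFourSum_le_of_le_smallBeta hU₁ hU₂ hF hd3 hβ₀ hφ₀ hβ hββ₀ hβc hμ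
      (hT (by omega) β hβ hβc μ hμ) hL2 hr).trans ?_
    calc 32 * 12 ^ d * r ^ d / L ^ d ≤ A₁ / L :=
          div_le_div_of_nonneg_left hA₁0 (by positivity) (Bound.le_self_pow_of_pos hL1 (by omega))
      _ ≤ ε := div_le_of_ge hA₁0 hε (by linarith)
  -- above `β₀`: Panis's Thm 5.5
  obtain ⟨C, γ, hC, hγ, HP⟩ := panis_ursellFourSum_le_holds hd
  set mx : ℝ := max (β₀ ^ (-4 : ℤ)) (β₀ ^ (-2 : ℤ)) with hmx
  have hmx0 : 0 ≤ mx := le_max_of_le_left (zpow_nonneg hβ₀.le _)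
  set A₃ : ℝ := C * mx * r ^ γ with hA₃
  have hA₃0 : 0 ≤ A₃ := by positivity
  refine ⟨max (A₁ / ε + 2) (A₃ / ε + 1), fun β L hβ hβc hL μ hμ => ?_⟩
  have hLs : A₁ / ε + 2 ≤ L := (le_max_left _ _).trans hL
  have hL3 : A₃ / ε + 1 ≤ L := (le_max_right _ _).trans hL
  have hL1 : 1 ≤ L := by have := div_nonneg hA₃0 hε.le; linarith
  rcases le_or_gt β β₀ with hββ₀ | hβ₀β
  · exact hsmall β L hβ hββ₀ hβc hLs μ hμ
  · have hβpos : 0 < β := hβ₀.trans hβ₀β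
    refine (HP β L r hβpos hβc hL1 hr μ hμ).trans ?_
    have hmax : max (β ^ (-4 : ℤ)) (β ^ (-2 : ℤ)) ≤ mx := by
      refine max_le_max ?_ ?_ <;>
      · rw [zpow_neg, zpow_neg, zpow_ofNat, zpow_ofNat]
        exact inv_anti₀ (pow_pos hβ₀ _) (pow_le_pow_left₀ hβ₀.le hβ₀β.le _)
    have hrγ : 0 ≤ r ^ γ := Real.rpow_nonneg hr0.le γ
    calc C * max (β ^ (-4 : ℤ)) (β ^ (-2 : ℤ)) * r ^ γ / L ^ (d - 4)
        ≤ A₃ / L ^ (d - 4) :=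
          div_le_div_of_nonneg_right (by
            rw [hA₃]
            exact mul_le_mul_of_nonneg_right (mul_le_mul_of_nonneg_left hmax hC.le) hrγ)
            (by positivity)
      _ ≤ A₃ / L := div_le_div_of_nonneg_left hA₃0 (by positivity)
          (Bound.le_self_pow_of_pos hL1 (by omega))
      _ ≤ ε := div_le_of_ge hA₃0 hε hL3

/-- Along a sequence with `δ_k → 0⁺`, `d ≥ 5`: `S(μ_k; 1/δ_k, r) → 0` for any states
`μ_k ∈ 𝒢(β_k, 0)`, `β_k ∈ [0, β_c]` (from `ursellFourSum_uniformlySmall_of_five_le`; compare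
`tendsto_ursellFourSum_of_uniformlySmall`). [folklore] -/
theorem tendsto_ursellFourSum_of_five_le (hd : 5 ≤ d) {β δ : ℕ → ℝ}
    (hβ : ∀ k, β k ∈ Set.Icc 0 (criticalBeta d)) (hδ : Tendsto δ atTop (𝓝[>] (0 : ℝ)))
    {μ : ℕ → Measure (SpinConfig (Site d))} (hμ : ∀ k, μ k ∈ isingGibbsMeasures d (β k) 0)
    {r : ℝ} (hr : 1 ≤ r) :
    Tendsto (fun k => ursellFourSum (μ k) (δ k)⁻¹ r) atTop (𝓝 0) := by
  have hLtop : Tendsto (fun k => (δ k)⁻¹) atTop atTop := tendsto_inv_nhdsGT_zero.comp hδ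
  rw [Metric.tendsto_atTop]
  intro ε hε
  obtain ⟨L₀, hL₀⟩ := ursellFourSum_uniformlySmall_of_five_le hd hr (half_pos hε)
  obtain ⟨N, hN⟩ := eventually_atTop.1 (hLtop.eventually (eventually_ge_atTop L₀))
  refine ⟨N, fun k hk => ?_⟩
  rw [Real.dist_eq, sub_zero, abs_of_nonneg (ursellFourSum_nonneg _ _ _)]
  exact (hL₀ (β k) (δ k)⁻¹ (hβ k).1 (hβ k).2 (hN k hk) (μ k) (hμ k)).trans_lt (half_lt_self hε)

universe u in
/-- **crit-ising.S13 for `d ≥ 5`, a theorem of the tree** (Aizenman, CMP 86 (1982), §1 with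
Prop. 12.1 and the tree diagram bound; Fröhlich, NPB 200 (1982); in the `Sweep1` form: arbitrary
temperatures `β_k ∈ [0, β_c]`, meshes `δ_k → 0⁺`, any renormalisation `ρ_k` with bounded second
moments — the hypothesis `ρ_k > 0` of the `Sweep1` statement is not needed). For the nearest-neighbour
Ising model on `ℤ^d`, `d ≥ 5`: if the rescaled spin fields `Φ_k(f) = ρ_k δ_k^d ∑_x f(δ_k x) σ_x` under
DLR states `μ_k ∈ 𝒢(β_k, 0)` have bounded second moments and converge in law, for every test function
`f`, to `Φ(f)` for a linear random functional `Φ` on a probability space `(Ω, P)`, then `Φ` is a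
Gaussian process. No named fact enters: Aizenman's Prop. 12.1 (`aizenman_wickDeviation_le_finite_holds`),
Newman's Gaussian inequality, the tree diagram bound (`aizenman_treeDiagramBound_holds`), Panis's
Thm 5.5 (`panis_ursellFourSum_le_holds`: infrared and sliding-scale bounds), uniqueness below and at
`β_c`, the free state, the variance bounds and the probabilistic assembly
(`isGaussianProcess_of_tendstoInDistribution_smearedSpin_of_seqBound`) are all proved in the tree. [cite: AizenmanCMP1982, §1 (Gaussianity of scaling limits for d > 4) with Prop. 12.1] -/
theorem isGaussianProcess_of_tendstoInDistribution_smearedSpin_of_five_le (hd : 5 ≤ d)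
    {β δ ρ : ℕ → ℝ} (hβ : ∀ k, β k ∈ Set.Icc 0 (criticalBeta d))
    (hδ : Tendsto δ atTop (𝓝[>] (0 : ℝ)))
    {μ : ℕ → ProbabilityMeasure (SpinConfig (Site d))}
    (hμ : ∀ k, (μ k : Measure (SpinConfig (Site d))) ∈ isingGibbsMeasures d (β k) 0)
    {Ω : Type u} [MeasurableSpace Ω] {P : Measure Ω} [IsProbabilityMeasure P]
    (Φ : TestFn d →ₗ[ℝ] Ω → ℝ)
    (hM2 : ∀ f : TestFn d, ∃ C : ℝ, ∀ k,
      ∫ σ, smearedSpin (ρ k) (δ k) f σ ^ 2 ∂(μ k : Measure (SpinConfig (Site d))) ≤ C)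
    (hCV : ∀ f : TestFn d,
      TendstoInDistribution (fun k σ => smearedSpin (ρ k) (δ k) f σ) atTop (Φ f)
        (fun k => (μ k : Measure (SpinConfig (Site d)))) P) :
    IsGaussianProcess (fun f ω => Φ f ω) P :=
  isGaussianProcess_of_tendstoInDistribution_smearedSpin_of_seqBound
    normalizedField_variance_bounds_holds (by omega) hβ hδ hμ Φ hM2 hCV
    fun r hr => ⟨fun k => 24 * ursellFourSum (μ k : Measure (SpinConfig (Site d))) (δ k)⁻¹ r,
      fun k => mul_nonneg (by norm_num) (ursellFourSum_nonneg _ _ _),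
      by simpa using (tendsto_ursellFourSum_of_five_le hd hβ hδ hμ hr).const_mul 24,
      fun k hδk {_} hf hfr z =>
        (abs_mgf_normalizedField_sub_exp_le_dlr (by omega) (hβ k).1 (hβ k).2 (inv_pos.2 hδk)
          (hμ k) hf hfr z).trans_eq (by ring)⟩

end Literature.Probability.LatticeModels

end
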